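import Mathlib
import Summits.Langlands.Langlands.Theorems.IrreducibilityBySelfDualityHeckeEigenvalueFieldStubLiftDiff
import Summits.Langlands.Langlands.Theorems.IrreducibilityBySelfDualityHeckeEigenvalueFieldStubDictW5
import Literature.NumberTheory.Automorphic.ResGLnConeDictionaryCone
import HarnessLib

/-!
# Smoothness and the explicit derivative of the lift of a family of cone forms —
crux `HeckeEigenvalueField` (stmt-Langlands-13632), line `Sketch`, stub END-SCALAR, part SMOOTH

Namespace `Summit.Langlands.Langlands.Theorems.HeckeEigenvalueField.Res`.  Theorems only; the
operator-norm topology on `M_n(K_∞)` throughout (the ResConeAnalytic preamble: the product-topology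
instances are removed so that `fderiv`/`ContDiffOn` of form-valued maps on `hermSpace` elaborate along
the normed path, as in the registered statement of END-SCALAR).

For a family `β_c` of `q`-forms on the hermitian space, smooth on the open positive cone, and its lift
`u(Y)(g, c) = E(g)⁻¹ β_c(sq g)(tg_g Y₁, …, tg_g Y_q)` to `G_∞ = GL_n(K_∞)` (`sq h = h hᴴ`,
`tg h Y = h Y hᴴ + h Yᴴ hᴴ`, `E = σS` the sign-twisted coefficient representation; all given abstractly
through `hsq`, `htg`, `hu` as in LIFT-INV/LIFT-DIFF):

* `stub_endScalar_contDiffAt_lift` — `m ↦ u(Y)(m, c)` is `C^∞` at every invertible matrix (matrix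
  coordinates on `G_∞`): `β_c` smooth on the open cone ∋ `m mᴴ`, `m ↦ m mᴴ` and `m ↦ tg_m Y`
  polynomial, `m ↦ E(m)⁻¹` smooth on the units (`stub_isDifferentiableRep_contDiffAt_matrix`, W5, and
  `contDiffAt_ringInverse`), evaluation of a smooth curve of continuous alternating forms on smooth
  arguments (`contDiffAt_continuousAlternatingMap_apply'`, basis expansion);
* `endScalar_hasDerivAt_lift` — the derivative of `t ↦ u(Y)(g e^{tX}, c)` at `0`, explicitly:
  `E(g)⁻¹ (Dβ_c(sq g)(tg_g X)(tg_g Y) + ∑_j β_c(sq g)(…, W_j, …)) - dE(X) u(Y)(g, c)` with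
  `W_j = d/dt|₀ tg_{g e^{tX}} Y_j` (Leibniz, `hasDerivAt_σS_inv`, LIFT-D's curve lemmas);
* `hasDerivAt_mul_expMem_of_matrix` — `d/dt|₀ f(g e^{tX}) = Df(g)(gX)` from matrix coordinates.

References: A. Borel, N. Wallach, *Continuous cohomology, discrete subgroups, and representations of
reductive groups*, 2nd ed. (2000), 0 §2.3 and VII 2.2–2.5. [BorelWallach2000]
-/

set_option linter.dupNamespace false -- project-wide: `Summit.Langlands.Langlands` is the mandated namespace

noncomputable section

open scoped Classical Matrix Matrix.Norms.Operator Topology TensorProduct ContDiff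
open Filter NumberField NumberField.mixedEmbedding Literature.NumberTheory.Automorphic
open Literature.NumberTheory.Automorphic.RealMatrixGroup

-- ResConeAnalytic preamble: ONE topology on `M_n(K_∞)` (the operator norm), so that the calculus of
-- form-valued maps on `hermSpace` elaborates along the normed path (as in the registered END-SCALAR).
attribute [-instance] instTopologicalSpaceMatrix
attribute [-instance] Matrix.instUniformSpace
attribute [local instance high] NormedAddCommGroup.toSeminormedAddCommGroup

namespace Summit.Langlands.Langlands.Theorems.HeckeEigenvalueField.Res

/-- **Smoothness of `m ↦ L(m) (x m)` from POINTWISE smoothness of the operator-valued map `L`**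
(finite-dimensional target: expand `x m` in a real basis). [folklore] -/
theorem contDiffAt_apply_of_pointwise {M E : Type*} [NormedAddCommGroup M] [NormedSpace ℝ M]
    [NormedAddCommGroup E] [NormedSpace ℂ E] [FiniteDimensional ℂ E] {N : WithTop ℕ∞}
    {L : M → Module.End ℂ E} {x : M → E} {m₀ : M}
    (hL : ∀ v, ContDiffAt ℝ N (fun m => L m v) m₀) (hx : ContDiffAt ℝ N x m₀) :
    ContDiffAt ℝ N (fun m => L m (x m)) m₀ := by
  let b := Module.finBasis ℂ E
  have hexp : (fun m => L m (x m)) = fun m => ∑ k, b.repr (x m) k • L m (b k) := by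
    funext m
    conv_lhs => rw [← b.sum_repr (x m)]
    rw [map_sum]
    exact Finset.sum_congr rfl fun k _ => (L m).map_smul _ _
  rw [hexp]
  refine ContDiffAt.sum fun k _ => ContDiffAt.smul ?_ (hL (b k))
  exact (LinearMap.toContinuousLinearMap ((b.coord k).restrictScalars ℝ)).contDiff.contDiffAt.comp m₀ hx

/-- **Smoothness of `m ↦ f(m)(v₁(m), …, v_q(m))` for a smooth curve of continuous alternating forms
and smooth arguments** (finite-dimensional source: expand the arguments in a real basis).
[folklore] -/
theorem contDiffAt_continuousAlternatingMap_apply' {M V W ι : Type*} [NormedAddCommGroup M]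
    [NormedSpace ℝ M] [NormedAddCommGroup V] [NormedSpace ℝ V] [FiniteDimensional ℝ V]
    [NormedAddCommGroup W] [NormedSpace ℝ W] [Fintype ι] [DecidableEq ι] {N : WithTop ℕ∞}
    {f : M → V [⋀^ι]→L[ℝ] W} {v : ι → M → V} {m₀ : M}
    (hf : ContDiffAt ℝ N f m₀) (hv : ∀ i, ContDiffAt ℝ N (v i) m₀) :
    ContDiffAt ℝ N (fun m => f m (fun i => v i m)) m₀ := by
  let b := Module.finBasis ℝ V
  have hexp : (fun m => f m (fun i => v i m)) = fun m =>
      ∑ r : ι → Fin (Module.finrank ℝ V), (∏ i, b.repr (v i m) (r i)) • f m (fun i => b (r i)) := by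
    funext m
    have h1 : (fun i => v i m) = fun i => ∑ j, b.repr (v i m) j • b j :=
      funext fun i => (b.sum_repr (v i m)).symm
    rw [h1, ContinuousAlternatingMap.map_sum]
    exact Finset.sum_congr rfl fun r _ => (f m).map_smul_univ _ _
  rw [hexp]
  refine ContDiffAt.sum fun r _ => ContDiffAt.smul (contDiffAt_prod fun i _ => ?_) ?_
  · exact (LinearMap.toContinuousLinearMap (b.coord (r i))).contDiff.contDiffAt.comp m₀ (hv i)
  · have happ := ((ContinuousMultilinearMap.apply ℝ (fun _ : ι => V) W (fun i => b (r i))).comp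
      (ContinuousAlternatingMap.toContinuousMultilinearMapCLM ℝ)).contDiff.contDiffAt.comp m₀ hf
    exact happ

variable {n : ℕ} {K : Type} [Field K] [NumberField K]

/-- **The hermitian-part retraction** `P : M_n(K_∞) →L[ℝ] hermSpace`, `P A = ½ (A + Aᴴ)`, a
continuous linear left inverse of the inclusion. [folklore] -/
theorem exists_hermRetraction (n : ℕ) (K : Type) [Field K] [NumberField K] :
    ∃ P : Matrix (Fin n) (Fin n) (mixedSpace K) →L[ℝ] ResGLnCone.hermSpace n K,
      ∀ A : Matrix (Fin n) (Fin n) (mixedSpace K), A ∈ ResGLnCone.hermSpace n K →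
        ((P A : ResGLnCone.hermSpace n K) : Matrix (Fin n) (Fin n) (mixedSpace K)) = A := by
  refine ⟨LinearMap.toContinuousLinearMap
    { toFun := fun A => ⟨(1 / 2 : ℝ) • (A + Aᴴ), by
        rw [ResGLnCone.mem_hermSpace_iff, Matrix.conjTranspose_smul, Matrix.conjTranspose_add,
          Matrix.conjTranspose_conjTranspose, star_trivial, add_comm]⟩
      map_add' := fun A B => Subtype.ext (by
        simp only [Matrix.conjTranspose_add, Submodule.coe_add]
        rw [← smul_add]; congr 1; abel)
      map_smul' := fun r A => Subtype.ext (by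
        simp only [Matrix.conjTranspose_smul, star_trivial, RingHom.id_apply, Submodule.coe_smul]
        rw [← smul_add, smul_comm]) }, fun A hA => ?_⟩
  change (1 / 2 : ℝ) • (A + Aᴴ) = A
  rw [(ResGLnCone.mem_hermSpace_iff _).1 hA, ← two_smul ℝ, smul_smul]
  norm_num

/-- The conjugate transpose of `M_n(K_∞)` as a continuous real-linear map. [folklore] -/
theorem exists_conjTransposeCLM (n : ℕ) (K : Type) [Field K] [NumberField K] :
    ∃ T : Matrix (Fin n) (Fin n) (mixedSpace K) →L[ℝ] Matrix (Fin n) (Fin n) (mixedSpace K),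
      ∀ A, T A = Aᴴ :=
  ⟨LinearMap.toContinuousLinearMap
    { toFun := fun A => Aᴴ
      map_add' := fun A B => Matrix.conjTranspose_add A B
      map_smul' := fun r A => by rw [Matrix.conjTranspose_smul, star_trivial]; rfl }, fun A => rfl⟩

/-- `m ↦ P (m mᴴ)` is smooth (for any continuous linear `P`). [folklore] -/
theorem contDiff_hermSquareM (P : Matrix (Fin n) (Fin n) (mixedSpace K) →L[ℝ] ResGLnCone.hermSpace n K) :
    ContDiff ℝ ∞ fun m : Matrix (Fin n) (Fin n) (mixedSpace K) => P (m * mᴴ) := by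
  obtain ⟨T, hT⟩ := exists_conjTransposeCLM n K
  have h := contDiff_id.mul T.contDiff (n := ∞) (𝕜 := ℝ)
  simp only [hT, id] at h
  exact P.contDiff.comp h

/-- `m ↦ P (m Y mᴴ + m Yᴴ mᴴ)` is smooth. [folklore] -/
theorem contDiff_hermTangentM (P : Matrix (Fin n) (Fin n) (mixedSpace K) →L[ℝ] ResGLnCone.hermSpace n K)
    (Y : Matrix (Fin n) (Fin n) (mixedSpace K)) :
    ContDiff ℝ ∞ fun m : Matrix (Fin n) (Fin n) (mixedSpace K) => P (m * Y * mᴴ + m * Yᴴ * mᴴ) := by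
  obtain ⟨T, hT⟩ := exists_conjTransposeCLM n K
  have h : ContDiff ℝ ∞ fun m : Matrix (Fin n) (Fin n) (mixedSpace K) => id m * Y * T m + id m * Yᴴ * T m :=
    ((contDiff_id.mul contDiff_const).mul T.contDiff).add ((contDiff_id.mul contDiff_const).mul T.contDiff)
  simp only [hT, id] at h
  exact P.contDiff.comp h

/-- On an invertible matrix `m`, `(archOfMatrix m)⁻¹ = archOfMatrix (m⁻¹)` (ring inverse). [folklore] -/
theorem archOfMatrix_ringInverse {m : Matrix (Fin n) (Fin n) (mixedSpace K)} (hm : IsUnit m) :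
    GLn.archOfMatrix n K (Ring.inverse m) = (GLn.archOfMatrix n K m)⁻¹ := by
  obtain ⟨u, rfl⟩ := hm
  rw [Ring.inverse_unit]
  refine Subtype.ext ?_
  rw [GLn.archOfMatrix_val, Subgroup.coe_inv, GLn.archOfMatrix_val]

/-- **`m ↦ E(m)⁻¹ v` is smooth at every invertible matrix** (`E = σS` an algebraic, hence
differentiable, representation; inversion is smooth on the units). [cite: BorelWallach2000, 0 §2.3] -/
theorem contDiffAt_σS_inv_apply (hcpt : isCompact_glFiniteIntegralLevel n K)
    (S : Finset {w : InfinitePlace K // w.IsReal}) (lam : (K →+* ℂ) → Fin n → ℤ)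
    (v : ResGLnCohomology.CoeffModule ℂ n K lam) {m₀ : Matrix (Fin n) (Fin n) (mixedSpace K)} (hm₀ : IsUnit m₀) :
    ContDiffAt ℝ ∞ (fun m : Matrix (Fin n) (Fin n) (mixedSpace K) =>
      ConeDictionary.σS hcpt S lam (GLn.archOfMatrix n K m)⁻¹ v) m₀ := by
  have hinv : IsUnit (Ring.inverse m₀) := by
    obtain ⟨u, rfl⟩ := hm₀
    rw [Ring.inverse_unit]
    exact Units.isUnit _
  have hW := (stub_isDifferentiableRep_contDiffAt_matrix (ResGLnCohomology.archCoeffRepSign n K S lam)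
    (ResGLnCohomology.archCoeffLie n K lam) (ResGLnCohomology.isDifferentiableRep_archCoeffSign n K S lam) hinv v).1
  have hW' : ContDiffAt ℝ ∞ (fun m : Matrix (Fin n) (Fin n) (mixedSpace K) =>
      ConeDictionary.σS hcpt S lam (GLn.archOfMatrix n K m) v) (Ring.inverse m₀) := hW
  have hcomp := hW'.comp m₀ (contDiffAt_ringInverse ℝ hm₀.unit)
  refine hcomp.congr_of_eventuallyEq ?_
  filter_upwards [Units.isOpen.mem_nhds hm₀] with m hm
  change _ = ConeDictionary.σS hcpt S lam (GLn.archOfMatrix n K (Ring.inverse m)) v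
  rw [archOfMatrix_ringInverse hm]
  rfl

/-- The hermitian square of an element of `G_∞` lies in the positive cone (`sq g = g · 1`). [folklore] -/
theorem sq_mem_posCone (hcpt : isCompact_glFiniteIntegralLevel n K)
    (sq : (AutomorphyDatum.gl n K hcpt).arch.carrier → ResGLnCone.hermSpace n K)
    (hsq : ∀ h : (AutomorphyDatum.gl n K hcpt).arch.carrier,
      (sq h : Matrix (Fin n) (Fin n) (mixedSpace K)) =
        ((h : GL (Fin n) (mixedSpace K)) : Matrix (Fin n) (Fin n) (mixedSpace K)) *
          (((h : GL (Fin n) (mixedSpace K)) : Matrix (Fin n) (Fin n) (mixedSpace K)))ᴴ)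
    (g : (AutomorphyDatum.gl n K hcpt).arch.carrier) : sq g ∈ ResGLnCone.posCone n K := by
  have h : sq g = ResGLnCone.coneAction n K (g : GL (Fin n) (mixedSpace K)) (ResGLnCone.hermOne n K) :=
    Subtype.ext (by rw [hsq, ResGLnCone.coe_coneAction, ResGLnCone.coe_hermOne, Matrix.mul_one])
  rw [h]
  exact ResGLnCone.mapsTo_coneAction_posCone n K _ (ResGLnCone.hermOne_mem_posCone n K)

set_option maxHeartbeats 400000 in
-- the datum-typed statement (abstract `sq`, `tg`, `u`) is large
/-- **The lift `m ↦ u(Y)(m, c) = E(m)⁻¹ β_c(m mᴴ)(tg_m Y₁, …)` is smooth at every invertible matrix**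
(matrix coordinates on `G_∞`, operator-norm topology): `β_c` is smooth on the open cone, which
contains `m mᴴ`; `m ↦ m mᴴ`, `m ↦ tg_m Y` are polynomial; `m ↦ E(m)⁻¹` is smooth on the units; and a
continuous alternating form is evaluated smoothly on smooth arguments. [cite: BorelWallach2000, VII 2.2] -/
theorem stub_endScalar_contDiffAt_lift {n : ℕ} {K : Type} [Field K] [NumberField K]
    (hcpt : isCompact_glFiniteIntegralLevel n K) (𝔫 : Ideal (𝓞 K))
    (S : Finset {w : InfinitePlace K // w.IsReal}) (lam : (K →+* ℂ) → Fin n → ℤ) {q : ℕ}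
    (sq : (AutomorphyDatum.gl n K hcpt).arch.carrier → ResGLnCone.hermSpace n K)
    (hsq : ∀ h : (AutomorphyDatum.gl n K hcpt).arch.carrier,
      (sq h : Matrix (Fin n) (Fin n) (mixedSpace K)) =
        ((h : GL (Fin n) (mixedSpace K)) : Matrix (Fin n) (Fin n) (mixedSpace K)) *
          (((h : GL (Fin n) (mixedSpace K)) : Matrix (Fin n) (Fin n) (mixedSpace K)))ᴴ)
    (tg : (AutomorphyDatum.gl n K hcpt).arch.carrier → (AutomorphyDatum.gl n K hcpt).arch.lie →
      ResGLnCone.hermSpace n K)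
    (htg : ∀ (h : (AutomorphyDatum.gl n K hcpt).arch.carrier) (Y : (AutomorphyDatum.gl n K hcpt).arch.lie),
      (tg h Y : Matrix (Fin n) (Fin n) (mixedSpace K)) =
        ((h : GL (Fin n) (mixedSpace K)) : Matrix (Fin n) (Fin n) (mixedSpace K)) *
            (Y : Matrix (Fin n) (Fin n) (mixedSpace K)) *
            (((h : GL (Fin n) (mixedSpace K)) : Matrix (Fin n) (Fin n) (mixedSpace K)))ᴴ +
          ((h : GL (Fin n) (mixedSpace K)) : Matrix (Fin n) (Fin n) (mixedSpace K)) *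
            (Y : Matrix (Fin n) (Fin n) (mixedSpace K))ᴴ *
            (((h : GL (Fin n) (mixedSpace K)) : Matrix (Fin n) (Fin n) (mixedSpace K)))ᴴ)
    (β : (BigHeckeGLn.FiniteAdelicGL n K ⧸ ResGLnCohomology.level n K 𝔫) →
      ResGLnCone.hermSpace n K → ResGLnCone.hermSpace n K [⋀^Fin q]→L[ℝ] ResGLnCohomology.CoeffModule ℂ n K lam)
    (hβs : ∀ c, ContDiffOn ℝ ((⊤ : ℕ∞) : WithTop ℕ∞) (β c) (ResGLnCone.posCone n K))
    (u : (Fin q → (AutomorphyDatum.gl n K hcpt).arch.lie) → (AutomorphyDatum.gl n K hcpt).arch.carrier →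
      BigHeckeGLn.FiniteAdelicGL n K → ResGLnCohomology.CoeffModule ℂ n K lam)
    (hu : ∀ Yt g c, u Yt g c = ConeDictionary.σS hcpt S lam g⁻¹
      (β (c : BigHeckeGLn.FiniteAdelicGL n K ⧸ ResGLnCohomology.level n K 𝔫) (sq g) (fun i => tg g (Yt i))))
    (Yt : Fin q → (AutomorphyDatum.gl n K hcpt).arch.lie) (c : BigHeckeGLn.FiniteAdelicGL n K)
    {m₀ : Matrix (Fin n) (Fin n) (mixedSpace K)} (hm₀ : IsUnit m₀) :
    ContDiffAt ℝ ∞ (fun m : Matrix (Fin n) (Fin n) (mixedSpace K) => u Yt (GLn.archOfMatrix n K m) c) m₀ := by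
  obtain ⟨P, hP⟩ := exists_hermRetraction n K
  have hco : ∀ m : Matrix (Fin n) (Fin n) (mixedSpace K), IsUnit m →
      (((GLn.archOfMatrix n K m : (AutomorphyDatum.gl n K hcpt).arch.carrier) : GL (Fin n) (mixedSpace K)) :
        Matrix (Fin n) (Fin n) (mixedSpace K)) = m := fun m hm => GLn.coe_archOfMatrix hm
  have hsqM : ∀ m : Matrix (Fin n) (Fin n) (mixedSpace K), IsUnit m →
      sq (GLn.archOfMatrix n K m) = P (m * mᴴ) := by
    intro m hm
    refine Subtype.ext ?_
    rw [hsq, hco m hm, hP _ (by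
      rw [ResGLnCone.mem_hermSpace_iff, Matrix.conjTranspose_mul, Matrix.conjTranspose_conjTranspose])]
  have htgM : ∀ m : Matrix (Fin n) (Fin n) (mixedSpace K), IsUnit m → ∀ Y : (AutomorphyDatum.gl n K hcpt).arch.lie,
      tg (GLn.archOfMatrix n K m) Y =
        P (m * (Y : Matrix (Fin n) (Fin n) (mixedSpace K)) * mᴴ +
          m * (Y : Matrix (Fin n) (Fin n) (mixedSpace K))ᴴ * mᴴ) := by
    intro m hm Y
    refine Subtype.ext ?_
    rw [htg, hco m hm, hP _ (by
      rw [ResGLnCone.mem_hermSpace_iff]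
      simp only [Matrix.conjTranspose_add, Matrix.conjTranspose_mul, Matrix.conjTranspose_conjTranspose,
        Matrix.mul_assoc]
      rw [add_comm])]
  have hev : (fun m : Matrix (Fin n) (Fin n) (mixedSpace K) => u Yt (GLn.archOfMatrix n K m) c) =ᶠ[𝓝 m₀]
      fun m => ConeDictionary.σS hcpt S lam (GLn.archOfMatrix n K m)⁻¹
        (β (c : BigHeckeGLn.FiniteAdelicGL n K ⧸ ResGLnCohomology.level n K 𝔫) (P (m * mᴴ))
          (fun i => P (m * (Yt i : Matrix (Fin n) (Fin n) (mixedSpace K)) * mᴴ +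
            m * (Yt i : Matrix (Fin n) (Fin n) (mixedSpace K))ᴴ * mᴴ))) := by
    filter_upwards [Units.isOpen.mem_nhds hm₀] with m hm
    rw [hu, hsqM m hm]
    simp only [htgM m hm]
  refine ContDiffAt.congr_of_eventuallyEq ?_ hev
  refine contDiffAt_apply_of_pointwise (fun v => contDiffAt_σS_inv_apply hcpt S lam v hm₀) ?_
  refine contDiffAt_continuousAlternatingMap_apply' ?_ (fun i => (contDiff_hermTangentM P _).contDiffAt)
  have hmem : P (m₀ * m₀ᴴ) ∈ ResGLnCone.posCone n K := by
    rw [← hsqM m₀ hm₀]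
    exact sq_mem_posCone hcpt sq hsq _
  have hβ' : ContDiffAt ℝ ∞ (β (c : BigHeckeGLn.FiniteAdelicGL n K ⧸ ResGLnCohomology.level n K 𝔫)) (P (m₀ * m₀ᴴ)) :=
    (hβs _).contDiffAt ((ResGLnCone.isOpen_posCone n K).mem_nhds hmem)
  exact hβ'.comp m₀ (contDiff_hermSquareM P).contDiffAt

/-- **The derivative of `t ↦ E(g e^{tY})⁻¹ v` at `0` is `-dE(Y) E(g)⁻¹ v`** (`E = σS` a
differentiable representation: `E(g e^{tY})⁻¹ = E(e^{-tY}) E(g)⁻¹`, weak derivative from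
`isDifferentiableRep_archCoeffSign`, strong in finite dimensions). [cite: BorelWallach2000, 0 §2.3] -/
theorem hasDerivAt_σS_inv (hcpt : isCompact_glFiniteIntegralLevel n K)
    (S : Finset {w : InfinitePlace K // w.IsReal}) (lam : (K →+* ℂ) → Fin n → ℤ)
    (g : (AutomorphyDatum.gl n K hcpt).arch.carrier) (Y : (AutomorphyDatum.gl n K hcpt).arch.lie)
    (v : ResGLnCohomology.CoeffModule ℂ n K lam) :
    HasDerivAt (fun t : ℝ => ConeDictionary.σS hcpt S lam
        (g * (AutomorphyDatum.gl n K hcpt).arch.expMem (t • Y))⁻¹ v)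
      (-(ConeDictionary.σ𝔤S hcpt lam Y (ConeDictionary.σS hcpt S lam g⁻¹ v))) 0 := by
  have hfun : (fun t : ℝ => ConeDictionary.σS hcpt S lam
      (g * (AutomorphyDatum.gl n K hcpt).arch.expMem (t • Y))⁻¹ v) =
      fun t => ConeDictionary.σS hcpt S lam ((AutomorphyDatum.gl n K hcpt).arch.expMem (t • (-Y)))
        (ConeDictionary.σS hcpt S lam g⁻¹ v) := by
    funext t
    rw [mul_inv_rev, map_mul, Module.End.mul_apply, smul_neg, RealMatrixGroup.expMem_neg]
  rw [hfun]
  refine hasDerivAt_of_dual fun ℓ => ?_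
  have h := (ResGLnCohomology.isDifferentiableRep_archCoeffSign n K S lam).hasDerivAt_coeff (-Y)
    (ConeDictionary.σS hcpt S lam g⁻¹ v) ℓ
  have e : ℓ (ConeDictionary.σ𝔤S hcpt lam (-Y) (ConeDictionary.σS hcpt S lam g⁻¹ v)) =
      ℓ (-(ConeDictionary.σ𝔤S hcpt lam Y (ConeDictionary.σS hcpt S lam g⁻¹ v))) := by
    rw [map_neg (ConeDictionary.σ𝔤S hcpt lam) Y, LinearMap.neg_apply]
  exact h.congr_deriv e

/-- **Derivative of a function on `G_∞` along `t ↦ g e^{tX}` from its derivative in matrix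
coordinates**: `d/dt|₀ f(g e^{tX}) = Df(g)(g X)`. [folklore] -/
theorem hasDerivAt_mul_expMem_of_matrix (hcpt : isCompact_glFiniteIntegralLevel n K)
    {V : Type*} [NormedAddCommGroup V] [NormedSpace ℝ V]
    (f : (AutomorphyDatum.gl n K hcpt).arch.carrier → V) (g : (AutomorphyDatum.gl n K hcpt).arch.carrier)
    (X : (AutomorphyDatum.gl n K hcpt).arch.lie)
    (hf : DifferentiableAt ℝ (fun m : Matrix (Fin n) (Fin n) (mixedSpace K) => f (GLn.archOfMatrix n K m))
      (((g : (AutomorphyDatum.gl n K hcpt).arch.carrier) : GL (Fin n) (mixedSpace K)) :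
        Matrix (Fin n) (Fin n) (mixedSpace K))) :
    HasDerivAt (fun t : ℝ => f (g * (AutomorphyDatum.gl n K hcpt).arch.expMem (t • X)))
      (fderiv ℝ (fun m : Matrix (Fin n) (Fin n) (mixedSpace K) => f (GLn.archOfMatrix n K m))
        (((g : (AutomorphyDatum.gl n K hcpt).arch.carrier) : GL (Fin n) (mixedSpace K)) :
          Matrix (Fin n) (Fin n) (mixedSpace K))
        ((((g : (AutomorphyDatum.gl n K hcpt).arch.carrier) : GL (Fin n) (mixedSpace K)) :
          Matrix (Fin n) (Fin n) (mixedSpace K)) * (X : Matrix (Fin n) (Fin n) (mixedSpace K)))) 0 := by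
  have hM := hasDerivAt_coe_mul_expMem (AutomorphyDatum.gl n K hcpt).arch g X
  have h := hf.hasFDerivAt.comp_hasDerivAt_of_eq 0 hM (by rw [mul_expMem_zero_smul])
  refine h.congr_of_eventuallyEq (Eventually.of_forall fun t => ?_)
  change f _ = f (GLn.archOfMatrix n K _)
  rw [ConeDictionary.archOfMatrix_coe_datum]

set_option maxHeartbeats 400000 in
-- the datum-typed statement (abstract `sq`, `tg`, `u`) is large
/-- **The derivative of the lift along `t ↦ g e^{tX}`, explicitly** (Leibniz: the `E(·)⁻¹`-factor
contributes `-dE(X) u`, the form factor `E(g)⁻¹ (Dβ_c(g gᴴ)(tg_g X)(tg_g Y) + ∑_j β_c(g gᴴ)(…, W_j, …))`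
with `W_j = d/dt|₀ tg_{g e^{tX}} Y_j`). [cite: BorelWallach2000, VII 2.2–2.5] -/
theorem endScalar_hasDerivAt_lift {n : ℕ} {K : Type} [Field K] [NumberField K]
    (hcpt : isCompact_glFiniteIntegralLevel n K) (𝔫 : Ideal (𝓞 K))
    (S : Finset {w : InfinitePlace K // w.IsReal}) (lam : (K →+* ℂ) → Fin n → ℤ) {q : ℕ}
    (sq : (AutomorphyDatum.gl n K hcpt).arch.carrier → ResGLnCone.hermSpace n K)
    (hsq : ∀ h : (AutomorphyDatum.gl n K hcpt).arch.carrier,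
      (sq h : Matrix (Fin n) (Fin n) (mixedSpace K)) =
        ((h : GL (Fin n) (mixedSpace K)) : Matrix (Fin n) (Fin n) (mixedSpace K)) *
          (((h : GL (Fin n) (mixedSpace K)) : Matrix (Fin n) (Fin n) (mixedSpace K)))ᴴ)
    (tg : (AutomorphyDatum.gl n K hcpt).arch.carrier → (AutomorphyDatum.gl n K hcpt).arch.lie →
      ResGLnCone.hermSpace n K)
    (htg : ∀ (h : (AutomorphyDatum.gl n K hcpt).arch.carrier) (Y : (AutomorphyDatum.gl n K hcpt).arch.lie),
      (tg h Y : Matrix (Fin n) (Fin n) (mixedSpace K)) =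
        ((h : GL (Fin n) (mixedSpace K)) : Matrix (Fin n) (Fin n) (mixedSpace K)) *
            (Y : Matrix (Fin n) (Fin n) (mixedSpace K)) *
            (((h : GL (Fin n) (mixedSpace K)) : Matrix (Fin n) (Fin n) (mixedSpace K)))ᴴ +
          ((h : GL (Fin n) (mixedSpace K)) : Matrix (Fin n) (Fin n) (mixedSpace K)) *
            (Y : Matrix (Fin n) (Fin n) (mixedSpace K))ᴴ *
            (((h : GL (Fin n) (mixedSpace K)) : Matrix (Fin n) (Fin n) (mixedSpace K)))ᴴ)
    (β : (BigHeckeGLn.FiniteAdelicGL n K ⧸ ResGLnCohomology.level n K 𝔫) →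
      ResGLnCone.hermSpace n K → ResGLnCone.hermSpace n K [⋀^Fin q]→L[ℝ] ResGLnCohomology.CoeffModule ℂ n K lam)
    (u : (Fin q → (AutomorphyDatum.gl n K hcpt).arch.lie) → (AutomorphyDatum.gl n K hcpt).arch.carrier →
      BigHeckeGLn.FiniteAdelicGL n K → ResGLnCohomology.CoeffModule ℂ n K lam)
    (hu : ∀ Yt g c, u Yt g c = ConeDictionary.σS hcpt S lam g⁻¹
      (β (c : BigHeckeGLn.FiniteAdelicGL n K ⧸ ResGLnCohomology.level n K 𝔫) (sq g) (fun i => tg g (Yt i))))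
    (Yt : Fin q → (AutomorphyDatum.gl n K hcpt).arch.lie) (g : (AutomorphyDatum.gl n K hcpt).arch.carrier)
    (c : BigHeckeGLn.FiniteAdelicGL n K) (X : (AutomorphyDatum.gl n K hcpt).arch.lie)
    (hβd : DifferentiableAt ℝ (β (c : BigHeckeGLn.FiniteAdelicGL n K ⧸ ResGLnCohomology.level n K 𝔫)) (sq g))
    (W : Fin q → ResGLnCone.hermSpace n K)
    (hW : ∀ j, (W j : Matrix (Fin n) (Fin n) (mixedSpace K)) =
      g.1.1 * X.1 * (Yt j).1 * g.1.1ᴴ + g.1.1 * (Yt j).1 * X.1ᴴ * g.1.1ᴴ + g.1.1 * X.1 * (Yt j).1ᴴ * g.1.1ᴴ +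
        g.1.1 * (Yt j).1ᴴ * X.1ᴴ * g.1.1ᴴ) :
    HasDerivAt (fun t : ℝ => u Yt (g * (AutomorphyDatum.gl n K hcpt).arch.expMem (t • X)) c)
      (ConeDictionary.σS hcpt S lam g⁻¹
          (fderiv ℝ (β (c : BigHeckeGLn.FiniteAdelicGL n K ⧸ ResGLnCohomology.level n K 𝔫)) (sq g) (tg g X)
              (fun j => tg g (Yt j)) +
            ∑ j, β (c : BigHeckeGLn.FiniteAdelicGL n K ⧸ ResGLnCohomology.level n K 𝔫) (sq g)
              (Function.update (fun j => tg g (Yt j)) j (W j))) -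
        ConeDictionary.σ𝔤S hcpt lam X (u Yt g c)) 0 := by
  have hc : HasDerivAt (fun t : ℝ => sq (g * (AutomorphyDatum.gl n K hcpt).arch.expMem (t • X))) (tg g X) 0 :=
    hasDerivAt_sq_mul_expMem _ sq hsq g X (tg g X) (htg g X)
  have hw : ∀ j, HasDerivAt
      (fun t : ℝ => tg (g * (AutomorphyDatum.gl n K hcpt).arch.expMem (t • X)) (Yt j)) (W j) 0 :=
    fun j => hasDerivAt_tg_mul_expMem _ tg htg g X (Yt j) (W j) (hW j)
  have hβc : HasDerivAt (fun t : ℝ => β (c : BigHeckeGLn.FiniteAdelicGL n K ⧸ ResGLnCohomology.level n K 𝔫)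
        (sq (g * (AutomorphyDatum.gl n K hcpt).arch.expMem (t • X))))
      (fderiv ℝ (β (c : BigHeckeGLn.FiniteAdelicGL n K ⧸ ResGLnCohomology.level n K 𝔫)) (sq g) (tg g X)) 0 :=
    hβd.hasFDerivAt.comp_hasDerivAt_of_eq 0 hc (by rw [mul_expMem_zero_smul])
  have key := hasDerivAt_continuousAlternatingMap_apply hβc (fun j => hw j)
  rw [mul_expMem_zero_smul] at key
  have hL := hasDerivAt_apply_of_hasDerivAt_pointwise (hasDerivAt_σS_inv hcpt S lam g X) key
  rw [mul_expMem_zero_smul] at hL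
  have hL' := hL.congr_of_eventuallyEq
    (f₁ := fun t : ℝ => u Yt (g * (AutomorphyDatum.gl n K hcpt).arch.expMem (t • X)) c)
    (Eventually.of_forall fun t => hu _ _ _)
  refine hL'.congr_deriv ?_
  rw [hu]

end Summit.Langlands.Langlands.Theorems.HeckeEigenvalueField.Res

end
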